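/-
Copyright (c) 2026. All rights reserved.
Released under Apache 2.0 license as described in the file LICENSE.
Authors: abc-iut cell, seat abc-iut-L6-t6 (bridge for abc-iut-L6-t4's `GlobalFrobenioidModels.lean`, Ex. 3.6 (iii)).
-/
import Literature.IUT.LogThetaLattice.GlobalFrobenioidModelsTorsorCategory
import HarnessLib

/-!
# [IUTchIII] Example 3.6 (iii): the identification `𝓕⊛_𝔪𝔬𝔡 ⥲ 𝓕⊛_MOD` in the printed direction

S. Mochizuki, *Inter-universal Teichmüller Theory III*, kurims manuscript (May 2020), Example 3.6 (iii),
p. 108 l. 18–22 [claim key Mochizuki2012, status disputed (D-0012)]: "by associating to an object `𝔍` … the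
arithmetic line bundle on `S_mod` obtained from the trivial arithmetic line bundle … by modifying the
integral structure … at `v ∈ 𝕍` in the fashion prescribed by `𝔍_v` … one thus obtains a natural isomorphism
of Frobenioids `𝓕⊛_𝔪𝔬𝔡 ⥲ 𝓕⊛_MOD` that induces the identity morphism `F^×_mod → F^×_mod` on the associated
rational function monoids".

With the categories `FrakCat` (`𝓕⊛_𝔪𝔬𝔡`) and `MODCat` (`𝓕⊛_MOD`) in place, the printed assignment IS a functor:
`toMOD : 𝓕⊛_𝔪𝔬𝔡 ⥤ 𝓕⊛_MOD`, `𝔍 ↦ 𝔍.toMOD` (abc-iut-L6-t4's object: the trivial torsor `F^×_mod` with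
trivializations `t_v(x) = β_v(x) − [λ_v]`), `(n, f) ↦ (x ↦ n·x + f)` — on the element `f` it
"induces the identity morphism `F^×_mod → F^×_mod`" (p.108 l.15–17, (ii); l.20–21, (iii)). It is
quasi-inverse to `toFrak` of `GlobalFrobenioidModelsTorsorCategory.lean` (`toMODCompToFrak : toMOD ⋙ toFrak ≅ 𝟭`,
components `(1, t)`/`(1, −t)` for the chosen witness `t`), hence
an equivalence of categories (`toMOD_isEquivalence`): the "natural isomorphism of Frobenioids" of (iii)
at the level of the underlying categories, compatible with Frobenius degrees and elements by construction.
Nothing here takes a side on [IUTchIII] Cor. 3.12; typed ≠ endorsed.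
-/

noncomputable section

namespace Literature.IUT.LogThetaLattice

namespace GlobalFrobenioidModels

open CategoryTheory Opposite Literature.AlgebraicGeometry.Frobenioids

universe u

variable {F : Type u} [Field F] {V : Type u} {Γ : V → Type u} [∀ v, AddCommGroup (Γ v)]
  {nonneg : ∀ v, AddSubmonoid (Γ v)} {β : ∀ v, Additive Fˣ →+ Γ v}

/-- The `𝓕⊛_MOD`-object `𝔍.toMOD` of a `𝓕⊛_𝔪𝔬𝔡`-object (abc-iut-L6-t4's `FrakObj.toMOD`: trivial torsor, `t_v = β_v − [λ_v]`).
([IUTchIII] Ex 3.6 (iii) p.108) [claim: Mochizuki2012, status: disputed] -/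
abbrev FrakCat.toMODObj (X : FrakCat F V Γ nonneg β) : MODCat F V Γ nonneg β :=
  MODCat.of (FrakObj.toMOD (F := F) (β := β) X.obj)

/-- The morphism `(n, f) : 𝔍₁ → 𝔍₂` read on the trivial torsors: `x ↦ n·x + f` (equivariant along `n`; its
integrality is the integrality of `f` w.r.t. `𝔍₁^{⊗n}`, `𝔍₂`). ([IUTchIII] Ex 3.6 (iii) p.108) [claim: Mochizuki2012, status: disputed] -/
def FrakCat.toMODHom {X Y : FrakCat F V Γ nonneg β} (φ : X ⟶ Y) : X.toMODObj ⟶ Y.toMODObj :=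
  ⟨FrakCat.deg φ, fun x => (FrakCat.deg φ : ℕ) • x + Additive.ofMul (FrakCat.fn φ), fun g x => by
    show (FrakCat.deg φ : ℕ) • (g + x) + Additive.ofMul (FrakCat.fn φ) =
      (FrakCat.deg φ : ℕ) • g + ((FrakCat.deg φ : ℕ) • x + Additive.ofMul (FrakCat.fn φ))
    rw [nsmul_add, add_assoc], fun v x => by
    have h := FrakCat.mem_nonneg φ v
    show β v ((FrakCat.deg φ : ℕ) • x + Additive.ofMul (FrakCat.fn φ)) - Y.obj.cls v -
      ((FrakCat.deg φ : ℕ) : ℤ) • (β v x - X.obj.cls v) ∈ nonneg v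
    rw [map_add, map_nsmul, ← natCast_zsmul, smul_sub]
    convert h using 1
    abel⟩

/-- **The identification `𝓕⊛_𝔪𝔬𝔡 ⥤ 𝓕⊛_MOD` of Ex. 3.6 (iii)** as a functor: `𝔍 ↦ 𝔍.toMOD`, `(n, f) ↦ (x ↦ n·x + f)`.
([IUTchIII] Ex 3.6 (iii) p.108) [claim: Mochizuki2012, status: disputed] -/
def toMOD : FrakCat F V Γ nonneg β ⥤ MODCat F V Γ nonneg β where
  obj X := X.toMODObj
  map φ := FrakCat.toMODHom φ
  map_id X := MODCat.hom_ext rfl (funext fun x => by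
    show ((1 : ℕ+) : ℕ) • x + Additive.ofMul (1 : Fˣ) = x
    rw [PNat.one_coe, one_smul, ofMul_one, add_zero])
  map_comp {X Y Z} φ ψ := MODCat.hom_ext rfl (funext fun x => by
    show ((FrakCat.deg ψ * FrakCat.deg φ : ℕ+) : ℕ) • x +
        Additive.ofMul (FrakCat.fn ψ * FrakCat.fn φ ^ (FrakCat.deg ψ : ℕ)) =
      (FrakCat.deg ψ : ℕ) • ((FrakCat.deg φ : ℕ) • x + Additive.ofMul (FrakCat.fn φ)) +
        Additive.ofMul (FrakCat.fn ψ)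
    rw [PNat.mul_coe, ← smul_smul, nsmul_add, ofMul_mul, ofMul_pow, add_assoc, add_comm (Additive.ofMul _)])

/-- `toMOD` "induces the identity morphism `F^×_mod → F^×_mod` on the associated rational function
monoids": the morphism `(n, f)` goes to the map of degree `n` translating by `f` itself. ([IUTchIII] Ex 3.6 (iii) p.108) [claim: Mochizuki2012, status: disputed] -/
theorem app_toMOD_map {X Y : FrakCat F V Γ nonneg β} (φ : X ⟶ Y) (x : Additive Fˣ) :
    MODCat.app (toMOD.map φ) x = (FrakCat.deg φ : ℕ) • x + Additive.ofMul (FrakCat.fn φ) := rfl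

/-- `toMOD` preserves degrees. ([IUTchIII] Ex 3.6 (iii) p.108) [claim: Mochizuki2012, status: disputed] -/
@[simp] theorem deg_toMOD_map {X Y : FrakCat F V Γ nonneg β} (φ : X ⟶ Y) :
    MODCat.deg (toMOD.map φ) = FrakCat.deg φ := rfl

/-- The component at `𝔍` of the comparison `toMOD ⋙ toFrak ≅ 𝟭`: `𝔍(𝔍.toMOD) = 𝔍 − (β_v(t))_v` for the chosen
witness `t ∈ F^×` of `𝔍.toMOD`, and `(1, t) : 𝔍(𝔍.toMOD) → 𝔍`, `(1, −t) : 𝔍 → 𝔍(𝔍.toMOD)` are mutually inverse.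
([IUTchIII] Ex 3.6 (iii) p.108) [claim: Mochizuki2012, status: disputed] -/
theorem cls_frak_toMODObj (X : FrakCat F V Γ nonneg β) (v : V) :
    (X.toMODObj).frak.cls v = X.obj.cls v - β v (MODCat.pt X.toMODObj : Additive Fˣ) := by
  rw [(MODCat.cls_frak)]
  show -(β v (MODCat.pt X.toMODObj : Additive Fˣ) - X.obj.cls v) = _
  rw [neg_sub]

/-- `(1, t)` is a morphism `𝔍(𝔍.toMOD) → 𝔍`. ([IUTchIII] Ex 3.6 (iii) p.108) [claim: Mochizuki2012, status: disputed] -/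
theorem isHom_unitHom (X : FrakCat F V Γ nonneg β) :
    FrakObj.IsHom (nonneg := nonneg) (β := β) (X.toMODObj).frak X.obj 1 (Additive.toMul (MODCat.pt X.toMODObj : Additive Fˣ)) := by
  refine (FrakObj.isHom_one_iff _ _ _).mpr fun v => ?_
  rw [ofMul_toMul, cls_frak_toMODObj]
  have : β v (MODCat.pt X.toMODObj : Additive Fˣ) + (X.obj.cls v - β v (MODCat.pt X.toMODObj : Additive Fˣ)) - X.obj.cls v = 0 := by abel
  rw [this]
  exact (nonneg v).zero_mem

/-- `(1, −t)` is a morphism `𝔍 → 𝔍(𝔍.toMOD)`. ([IUTchIII] Ex 3.6 (iii) p.108) [claim: Mochizuki2012, status: disputed] -/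
theorem isHom_unitInv (X : FrakCat F V Γ nonneg β) :
    FrakObj.IsHom (nonneg := nonneg) (β := β) X.obj (X.toMODObj).frak 1 (Additive.toMul (-(MODCat.pt X.toMODObj : Additive Fˣ))) := by
  refine (FrakObj.isHom_one_iff _ _ _).mpr fun v => ?_
  rw [ofMul_toMul, cls_frak_toMODObj, map_neg]
  have : -β v (MODCat.pt X.toMODObj : Additive Fˣ) + X.obj.cls v - (X.obj.cls v - β v (MODCat.pt X.toMODObj : Additive Fˣ)) = 0 := by abel
  rw [this]
  exact (nonneg v).zero_mem

/-- **`toMOD ⋙ toFrak ≅ 𝟭`**: the identification of (iii) followed by `𝓣 ↦ 𝔍(𝓣)` is naturally isomorphic to the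
identity (components `(1, t)`). ([IUTchIII] Ex 3.6 (iii) p.108) [claim: Mochizuki2012, status: disputed] -/
def toMODCompToFrak : (toMOD ⋙ toFrak : FrakCat F V Γ nonneg β ⥤ FrakCat F V Γ nonneg β) ≅ 𝟭 _ :=
  NatIso.ofComponents
    (fun X => ⟨FrakCat.homMk 1 _ (isHom_unitHom X), FrakCat.homMk 1 _ (isHom_unitInv X),
      FrakCat.hom_ext rfl (by
        apply Additive.ofMul.injective
        simp only [FrakCat.fn_comp, FrakCat.fn_homMk, FrakCat.deg_homMk, FrakCat.fn_id, PNat.one_coe,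
          pow_one, ofMul_mul, ofMul_toMul, ofMul_one, neg_add_cancel]),
      FrakCat.hom_ext rfl (by
        apply Additive.ofMul.injective
        simp only [FrakCat.fn_comp, FrakCat.fn_homMk, FrakCat.deg_homMk, FrakCat.fn_id, PNat.one_coe,
          pow_one, ofMul_mul, ofMul_toMul, ofMul_one, add_neg_cancel])⟩)
    (fun {X Y} φ => FrakCat.hom_ext (by
        show 1 * FrakCat.deg φ = FrakCat.deg φ * 1
        rw [one_mul, mul_one]) (by
        apply Additive.ofMul.injective
        simp only [Functor.comp_map, Functor.id_map, FrakCat.fn_comp, FrakCat.fn_homMk,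
          FrakCat.deg_homMk, fn_toFrak_map, MODCat.fnOf, app_toMOD_map, PNat.one_coe, pow_one,
          ofMul_mul, ofMul_pow, ofMul_toMul]
        change (MODCat.pt Y.toMODObj : Additive Fˣ) +
            ((FrakCat.deg φ : ℕ) • (MODCat.pt X.toMODObj : Additive Fˣ) + Additive.ofMul (FrakCat.fn φ) -
              (MODCat.pt Y.toMODObj : Additive Fˣ)) =
          Additive.ofMul (FrakCat.fn φ) + (FrakCat.deg φ : ℕ) • (MODCat.pt X.toMODObj : Additive Fˣ)
        abel))

/-- **The identification `𝓕⊛_𝔪𝔬𝔡 ⥲ 𝓕⊛_MOD` is an equivalence of categories** (the "natural isomorphism of Frobenioids"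
of Ex. 3.6 (iii), underlying categories). ([IUTchIII] Ex 3.6 (iii) p.108) [claim: Mochizuki2012, status: disputed] -/
instance toMOD_isEquivalence : (toMOD : FrakCat F V Γ nonneg β ⥤ MODCat F V Γ nonneg β).IsEquivalence :=
  haveI : (toMOD ⋙ toFrak : FrakCat F V Γ nonneg β ⥤ FrakCat F V Γ nonneg β).IsEquivalence :=
    Functor.isEquivalence_of_iso toMODCompToFrak.symm
  Functor.isEquivalence_of_comp_right toMOD toFrak

/-- The identification is compatible with the Frobenioid structures: `toMOD ⋙ (structure of 𝓕⊛_MOD)` is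
naturally isomorphic to the structure of `𝓕⊛_𝔪𝔬𝔡` (both factor through `toFrak`). ([IUTchIII] Ex 3.6 (iii) p.108) [claim: Mochizuki2012, status: disputed] -/
def toMODCompStructure (H : ModelHyps nonneg β) :
    (toMOD ⋙ structureFunctorMOD H : FrakCat F V Γ nonneg β ⥤ _) ≅ structureFunctor H :=
  (Functor.associator _ _ _).symm ≪≫ Functor.isoWhiskerRight toMODCompToFrak (structureFunctor H) ≪≫
    (structureFunctor H).leftUnitor

end GlobalFrobenioidModels

end Literature.IUT.LogThetaLattice
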